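import Literature.Topology.FourManifolds.RebuildLowerArchFormulas
import HarnessLib

/-!
# The rebuilt attaching circle along its upper arch: explicit formulas

Topic `Literature/Topology/FourManifolds`; fact seat `provefact-IsStrictHandleSlide.isSurgery`
(R. C. Kirby, *The Topology of 4-Manifolds*, LNM 1374 (1989), Ch. I §4; remaining content: the
named fact (S) `Literature.Topology.FourManifolds.FramedLink.IsStrictHandleSlide.slideModel`).
Mirror of `RebuildLowerArchFormulas.lean` for the upper arch `cUp` of the rebuilt attaching
circle (parameters `t ∈ [thi, ahi)`, `BandCoreRebuild.lean`): `cUp t = (cUpAux (-t))₀, -(cUpAux (-t))₁)`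
with `cUpAux = planarArch (-ahi) (-thi) ε' (v ↦ -fUp (-v)) (v ↦ -gUp (-v))`, `ε' = epsHi`, so that
`cUp t 0 = smoothStep (-ahi + ε') (-thi - ε') (-t)` (non-increasing in `t`) and
`cUp t 1 = (1 - S₂ (-t)) fUp t + S₂ (-t) gUp t`, `S₂ = smoothStep (-ahi + 2ε') (-thi - 2ε')`.
Proved here (no definitions, no named facts):

* `BandCore.curve_rebuild_eq_band_cUp`, `BandCore.cUp_apply_zero'`, `BandCore.cUp_apply_one'`,
  plateaux `cUp_fst_eq_zero_of_ge`, `cUp_fst_eq_one_of_le`, `cUp_snd_eq_fUp_of_ge`,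
  `cUp_snd_eq_gUp_of_le`, and `deriv_cUp_fst_nonpos`, `deriv_cUp_fst_neg`, `cUp_fst_mem_Icc'`
  (smoothness of `cUp`: the tree's `BandCore.contDiff_cUp`).

## References

* R. C. Kirby, *The Topology of 4-Manifolds*, LNM 1374, Springer (1989), Ch. I §4. [Kirby1989]
-/

open scoped Manifold ContDiff Topology Real
open Function Set Metric

noncomputable section

namespace Literature.Topology.FourManifolds

namespace BandCore

variable {A B : Knot} {avoid : Set (Metric.sphere (0 : EuclideanSpace ℝ (Fin 4)) 1)} (c : BandCore A B avoid)

/-- **On `[thi, ahi)` the rebuilt knot is the band image of the upper arch.** [folklore] -/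
theorem curve_rebuild_eq_band_cUp (hAB : Disjoint (range ⇑A) (range ⇑B)) {s : ℝ} (hs : s ∈ Ico c.thi c.ahi) :
    Knot.curve (c.rebuild hAB) s =
      ((c.band (c.cUp s) : Metric.sphere (0 : EuclideanSpace ℝ (Fin 4)) 1) : EuclideanSpace ℝ (Fin 4)) := by
  have hm := c.marks_lt
  have hlt : c.ahi < c.alo + 1 := by linarith [hm.2.2.2.2.2.1, hm.2.2.2.2.2.2.1, hm.2.2.2.2.2.2.2]
  rw [c.curve_rebuild_eq_pieceFun hAB ⟨by linarith [hs.1, hm.2.2.1, hm.2.2.2.1], hs.2.trans hlt⟩,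
    c.pieceFun_of_thi_le hs.1 hs.2]

/-- `0 < ε'` and `-ahi + 2 ε' < -thi - 2 ε'`. [folklore] -/
theorem epsHi_pos' : 0 < c.epsHi := c.cUp_hyp.1

/-- `thi + 2 ε' < ahi - 2 ε'`. [folklore] -/
theorem thi_add_lt_ahi_sub : c.thi + 2 * c.epsHi < c.ahi - 2 * c.epsHi := by
  have := c.cUp_hyp.2.1; linarith

/-- The first coordinate of the upper arch. [folklore] -/
theorem cUp_apply_zero' (t : ℝ) : c.cUp t 0 = smoothStep (-c.ahi + c.epsHi) (-c.thi - c.epsHi) (-t) := by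
  rw [c.cUp_apply_zero, c.cUpAux_eq_planarArch]; rfl

/-- The height of the upper arch. [folklore] -/
theorem cUp_apply_one' (t : ℝ) : c.cUp t 1 =
    (1 - smoothStep (-c.ahi + 2 * c.epsHi) (-c.thi - 2 * c.epsHi) (-t)) * c.fUp t +
      smoothStep (-c.ahi + 2 * c.epsHi) (-c.thi - 2 * c.epsHi) (-t) * c.gUp t := by
  rw [c.cUp_apply_one, c.cUpAux_eq_planarArch]
  simp only [planarArch, pt2_apply_one, neg_neg]
  ring

/-- After `ahi - ε'` the upper arch is on the left edge. [folklore] -/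
theorem cUp_fst_eq_zero_of_ge {t : ℝ} (ht : c.ahi - c.epsHi ≤ t) : c.cUp t 0 = 0 := by
  rw [c.cUp_eq_left ht]; rfl

/-- Before `thi + ε'` the upper arch is on the right edge. [folklore] -/
theorem cUp_fst_eq_one_of_le {t : ℝ} (ht : t ≤ c.thi + c.epsHi) : c.cUp t 0 = 1 := by
  rw [c.cUp_eq_right ht]; rfl

/-- After `ahi - 2ε'` the height of the upper arch is `fUp`. [folklore] -/
theorem cUp_snd_eq_fUp_of_ge {t : ℝ} (ht : c.ahi - 2 * c.epsHi ≤ t) : c.cUp t 1 = c.fUp t := by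
  rw [c.cUp_apply_one', smoothStep_of_le (by have := c.thi_add_lt_ahi_sub; linarith) (by linarith)]
  ring

/-- Before `thi + 2ε'` the height of the upper arch is `gUp`. [folklore] -/
theorem cUp_snd_eq_gUp_of_le {t : ℝ} (ht : t ≤ c.thi + 2 * c.epsHi) : c.cUp t 1 = c.gUp t := by
  rw [c.cUp_apply_one', smoothStep_of_ge (by have := c.thi_add_lt_ahi_sub; linarith) (by linarith)]
  ring

/-- The first coordinate of the upper arch lies in `[0, 1]`. [folklore] -/
theorem cUp_fst_mem_Icc' (t : ℝ) : c.cUp t 0 ∈ Icc (0 : ℝ) 1 := by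
  rw [c.cUp_apply_zero']; exact smoothStep_mem_Icc _ _ _

/-- The derivative of the first coordinate of the upper arch. [folklore] -/
theorem hasDerivAt_cUp_fst (t : ℝ) :
    HasDerivAt (fun t ↦ c.cUp t 0) (-deriv (smoothStep (-c.ahi + c.epsHi) (-c.thi - c.epsHi)) (-t)) t := by
  rw [show (fun t ↦ c.cUp t 0) = fun t ↦ smoothStep (-c.ahi + c.epsHi) (-c.thi - c.epsHi) (-t) from
    funext fun t ↦ c.cUp_apply_zero' t]
  have hs : HasDerivAt (smoothStep (-c.ahi + c.epsHi) (-c.thi - c.epsHi))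
      (deriv (smoothStep (-c.ahi + c.epsHi) (-c.thi - c.epsHi)) (-t)) (-t) :=
    (((contDiff_smoothStep _ _).differentiable (by simp)) _).hasDerivAt
  have := hs.comp t (hasDerivAt_neg t)
  refine this.congr_deriv ?_
  ring

/-- The first coordinate of the upper arch is non-increasing. [folklore] -/
theorem deriv_cUp_fst_nonpos (t : ℝ) : deriv (fun t ↦ c.cUp t 0) t ≤ 0 := by
  rw [(c.hasDerivAt_cUp_fst t).deriv]
  have h := c.thi_add_lt_ahi_sub
  have hε := c.epsHi_pos'
  have := deriv_smoothStep_nonneg (a := -c.ahi + c.epsHi) (b := -c.thi - c.epsHi) (by linarith) (-t)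
  linarith

/-- The first coordinate of the upper arch is strictly decreasing across `(thi + ε', ahi - ε')`.
[folklore] -/
theorem deriv_cUp_fst_neg {t : ℝ} (ht : t ∈ Ioo (c.thi + c.epsHi) (c.ahi - c.epsHi)) :
    deriv (fun t ↦ c.cUp t 0) t < 0 := by
  rw [(c.hasDerivAt_cUp_fst t).deriv]
  have h := c.thi_add_lt_ahi_sub
  have hε := c.epsHi_pos'
  have := deriv_smoothStep_pos (a := -c.ahi + c.epsHi) (b := -c.thi - c.epsHi) (by linarith) (x := -t)
    ⟨by linarith [ht.2], by linarith [ht.1]⟩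
  linarith

end BandCore

end Literature.Topology.FourManifolds
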